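import Summits.QuantumFields.YangMills.Theorems.BalabanUVNodesN15FullPropagatorSizedNonVanishing
import Summits.QuantumFields.YangMills.Theorems.BalabanUVNodesN15AtReadingOfRecord13CoPHV1XSized
import HarnessLib

/-!
# Route «BalabanUVNodes», cluster K4 «SpineRates» — node N15 = NE2: R3-bis — THE KERNEL NON-VANISHING LETTER FOR THE GAUGE-DRESSED (v3-CANDIDATE) FAMILY:
# dag-n15-c's all-covariant exactly dressed family `fgFamilyV1XAS` AT THE TRIVIAL BACKGROUND is Bałaban's genuine two-grid defect `⊗ 1_𝔤`, hence NOT the zero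
# kernel family; an `NE2Objects₁₁` with all operator kernels zero is NOT `v1XASObjects …`; the body of a v3 pin `N15PinnedV1XAS 𝔯` fails for zero-kernel readings

Cell `pub-ymgap`, WIDTH SEAT `pub-ymgap-dag-n15-w1` (HUMAN RULING D-0149), generation 0, file R3-bis.  Filed `--kind proof --supports stmt-QuantumFields-20544 --as helper` —
COUNT-NEUTRAL; theorems only (0 `def`, 0 `sorry`); imports this seat's R3 `…N15FullPropagatorSizedNonVanishing` (p593525) and dag-n15-a's S-F
`…N15AtReadingOfRecord13CoPHV1XSized` (p592513: `v1XASObjects`, the v3 pin faces `keyedLive_of_pinnedV1XAS` ∕ `live_and_n15At_rrOfRecord_of_pinnedV1XAS`; through it dag-n15-c FILEs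
24∕30∕38∕40 `bgOpsM₂RCC`, `fgFamilyV1XA(S)`, `v1cfgFX`∕`v1cfgCX`); nothing in the tree is modified or re-declared.

WHY.  R3 (p593525) made the zero-kernel exclusion a theorem for the v2 pin target `fullGSizedObjects` (Bałaban's genuine `U ≡ 1` kernels).  The v2 header anticipates a v3
RE-PIN of the N15 slot to a BACKGROUND-DRESSED operator layer; dag-n15-a g18∕S-F typed its faces for dag-n15-c's sized gauge-dressed objects `v1XASObjects 3 𝔄 ι e F.hL b a_S α β c₃₅ p`
(`keyedLive_of_pinnedV1XAS`, `live_and_n15At_rrOfRecord_of_pinnedV1XAS`, pin body `∃ b a_S α β c₃₅ p, 0 < b ∧ 0 < a_S ∧ 0 < c₃₅ ∧ ∀ F θ hP g₀ os k, (𝔯.lit …).ne2 k = v1XASObjects …`).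
The same R3 objection (dag-n15-w2 p588191: zero kernels pass every carrier guard) would stand against that pin unless the dressed family is known NOT to be the zero kernel
family.  THIS FILE: at the carrier's trivial configuration `A′ = 0` (`Bf.one`) every coefficient of Bałaban's `V′₁(A)` vanishes (`ad 0 = 0`, `F′_η(0) = 0`), the Neumann-dressed
pair `X̂ = (1 − ĜV̂)⁻¹Ĝ` IS `Ĝ` (`bgPropV_zero_right`), so entry 0 of the all-covariant family is `𝔇(G′ ⊗ 1, G ⊗ 1) = 𝔇(G′, G) ⊗ 1_ι` (`idef_tensorId`) — and `𝔇(G′, G) = G′P − PG ≠ 0`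
at every index with `m ≥ 1` is R3 §2 `exists_twoGridDefect_apply_ne_zero`.  Exact algebra; no estimate.

WHAT.  §1 zero-configuration identities (`coordMat_zero`, `Phi2_apply_zero`, `v1coefCX_fieldsOfGauge_zero`, `v1coefAX_fieldsOfGauge_zero`, `v1cfgFX_zero`, `v1cfgCX_zero`,
`unstackM_zero`, `bgPropV_zero_right`, `bgPairM_zero`, `bgOpsM₂RCC_zero_of_cfg_zero`); §2 ★★ `exists_fgFamilyV1XA_e_ne_zero` (every index with `m ≥ 1`, at `A′ = 0`), ★★
`fgFamilyV1XAS_ne_zero`, `ne_v1XASObjects_of_kop_zero`; §3 GENERIC `ne_of_kop_zero_of_exists_ne`, `not_pin_of_kop_zero` (any pin target with one non-vanishing operator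
kernel entry excludes the zero-kernel readings — future pins need only their target's letter); §4 (`d + 1 = 4`, any `N`) ★★★ `not_v1XASPin_of_kop_zero`, `exists_kop_ne_zero_of_v1XASPin`.

HONEST FRAMING.  Helper lane, count-neutral.  An exact algebraic letter about dag-n15-c's MODEL-LEVEL (species) objects at the trivial background (non-degeneracy of a v3 pin
CANDIDATE — the plan pins, not this seat; K3⁷ v2 of record 145a664ea9c38a7b is unchanged); no estimate, no datum content; nothing of Bałaban's analysis asserted; NE2⁺ NOT PRINTED ∕
NOT PROVED; N15 NOT discharged (typed 28∕28 · discharged 5∕27, A 5∕28 UNMOVED); K3⁷ OPEN, not claimed.  The Yang–Mills mass gap (Clay) is NOT proved by any of this — R4 closes the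
conditional finite-𝕋⁴ rung `BalabanLadder.UV` only; nothing continuum ∕ ℝ⁴ ∕ OS ∕ infinite volume.  Restate-immune (no Theses import).
-/

set_option autoImplicit false

namespace Summit.QuantumFields.YangMills.BalabanUVNodes.N15.SizedNonVanishing

open Finset
open NormedSpace
open Literature.MathematicalPhysics.QuantumFieldTheory.Balaban1983to89
open Literature.MathematicalPhysics.QuantumFieldTheory.Balaban1983to89.B5Prop11Plancherel (Tor fine unitVec)
open Literature.MathematicalPhysics.QuantumFieldTheory.Balaban1983to89.T4EtaRateDefect (idef idef_apply)
open Literature.MathematicalPhysics.QuantumFieldTheory.Balaban1983to89.T4EtaRateCoeffDefect (pull pull_apply)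
open Literature.MathematicalPhysics.QuantumFieldTheory.Balaban1983to89.B11SectG (BlockNorm)
open Literature.MathematicalPhysics.QuantumFieldTheory.Balaban1983to89.B11AxialTransport190 (abs_le_loc_ofBlocks)
open Literature.MathematicalPhysics.QuantumFieldTheory.Balaban1983to89.B6UnitTorusCarrier (unitTorusGeo)
open Literature.MathematicalPhysics.QuantumFieldTheory.Balaban1983to89.T4Continuum (T4Family ULoop)
open Literature.MathematicalPhysics.QuantumFieldTheory.Balaban1983to89.Beta.AveragingCorrectionJets (adCLM adCLM_zero)
open Summit.QuantumFields.YangMills.BalabanUVNodes.N15.TwoGrid (gOp TGIndex)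
open Summit.QuantumFields.YangMills.BalabanUVNodes.N15.VectorPiece (kingPrV blkFine tensorId tensorId_apply idef_tensorId)
open Summit.QuantumFields.YangMills.BalabanUVNodes.N15.MatrixSpecies (liftMap liftBlk coordMat coordMat_sub Phi2 blockAvgV mmulOp)
open Summit.QuantumFields.YangMills.BalabanUVNodes.N15.BackgroundLayer (projO stack projO_none_comp_stack bgPropV bgPropV_fix unstackM unstackM_apply bgPairM bgOpsM₂RCC
  v1fieldsOfGauge v1coefCX v1coefAX gavgM gavgM_zero v1cfgFX v1cfgCX fgInstanceV1G fgFamilyV1XA fgInstanceV1GS fgFamilyV1XAS sizedBase)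
open Summit.QuantumFields.YangMills.BalabanUVNodes.N15.GenuineRecord (TGIndexS v1XASObjects)
open Summit.QuantumFields.YangMills.BalabanUVNodes.N15.AtKeyedHome (neZero_blockFactor)
open Node00 (Stage13HParams NE2Objects₁₁)
open YMDAG.UVSplit (RateReading₁₃CoPH)

variable {d : ℕ}

/-! ## §1 At the trivial background every coefficient of `V′₁(A)` vanishes and the dressed pair is the `U ≡ 1` pair -/

section ZeroCfg

variable {𝔄 : Type} [NormedRing 𝔄] [NormedAlgebra ℝ 𝔄] [CompleteSpace 𝔄] {ι : Type} [Fintype ι] [DecidableEq ι] (e : 𝔄 ≃L[ℝ] (ι → ℝ))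

omit [CompleteSpace 𝔄] in
/-- The coordinate matrix of the zero operator is zero. [folklore] -/
theorem coordMat_zero : coordMat e (0 : 𝔄 →L[ℝ] 𝔄) = 0 := by
  have h := coordMat_sub e (0 : 𝔄 →L[ℝ] 𝔄) 0
  rwa [sub_self, sub_self] at h

/-- `F′_η(0) = 0` (both branches of part 13a's `Phi2`, any complete normed algebra). [folklore] -/
theorem Phi2_apply_zero {𝔸 : Type} [NormedRing 𝔸] [NormedAlgebra ℝ 𝔸] [CompleteSpace 𝔸] (η : ℝ) : Phi2 η (0 : 𝔸) = 0 := by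
  by_cases hη : η = 0
  · subst hη; simp
  · simp only [Phi2, if_neg hη, smul_zero, NormedSpace.exp_zero, sub_self]

/-- At `A = 0` the exact zeroth-order coefficient of (3.52) vanishes. [cite: Balaban1985BackgroundPropagators, (3.50)–(3.52) p.400 (shape)] -/
theorem v1coefCX_fieldsOfGauge_zero {X J : Type} [Fintype J] (s : J → X ≃ X) (η : ℝ) :
    v1coefCX e η (v1fieldsOfGauge 𝔄 J s η (0 : J → X → 𝔄)) = 0 := by
  funext x
  simp [v1coefCX, v1fieldsOfGauge, Phi2_apply_zero, coordMat_zero]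

/-- At `A = 0` the exact first-order coefficients of (3.52) vanish. [cite: Balaban1985BackgroundPropagators, (3.50)–(3.52) p.400 (shape)] -/
theorem v1coefAX_fieldsOfGauge_zero {X J : Type} [Fintype J] (s : J → X ≃ X) (η : ℝ) :
    v1coefAX e η (v1fieldsOfGauge 𝔄 J s η (0 : J → X → 𝔄)) = 0 := by
  funext j x
  cases j <;> simp [v1coefAX, v1fieldsOfGauge, Phi2_apply_zero, coordMat_zero]

/-- THE FINE COEFFICIENT READING AT `A′ = 0` IS `(0, 0)`. [bookkeeping] -/
theorem v1cfgFX_zero {X' J : Type} [Fintype J] (s' : J → X' ≃ X') (η' : ℝ) : v1cfgFX 𝔄 ι e s' η' (0 : J → X' → 𝔄) = (0, 0) := by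
  rw [v1cfgFX, v1coefCX_fieldsOfGauge_zero, v1coefAX_fieldsOfGauge_zero]

/-- THE COARSE COEFFICIENT READING AT `A′ = 0` IS `(0, 0)` (the block mean of the zero field is zero: dag-n15-c's `gavgM_zero`). [bookkeeping] -/
theorem v1cfgCX_zero {X X' J : Type} [Fintype J] [Fintype X'] [DecidableEq X] (π : X' → X) (s : J → X ≃ X) (η : ℝ) :
    v1cfgCX 𝔄 ι e π s η (0 : J → X' → 𝔄) = (0, 0) := by
  rw [v1cfgCX, gavgM_zero, v1coefCX_fieldsOfGauge_zero, v1coefAX_fieldsOfGauge_zero]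

end ZeroCfg

section ZeroPair

variable {X X' X₂ J ι : Type} [Fintype ι] [Fintype J]

/-- The unstacked first-order perturbation with ZERO coefficients is the zero map. [folklore] -/
theorem unstackM_zero [Fintype X] : unstackM (0 : X → Matrix ι ι ℝ) (0 : J → X → Matrix ι ι ℝ) = 0 :=
  LinearMap.ext fun f => funext fun p => by simp [unstackM_apply]

/-- `X(0) = Ĝ`: the Neumann-dressed propagator of the ZERO perturbation is the `U ≡ 1` piece ((3.65) with `V = 0`). [cite: Balaban1985BackgroundPropagators, (3.65) p.403 (shape)] -/
theorem bgPropV_zero_right [Fintype X] [Fintype X₂] [DecidableEq X] [DecidableEq X₂] (G : (X → ℝ) →ₗ[ℝ] (X₂ → ℝ)) :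
    bgPropV G (0 : (X₂ → ℝ) →ₗ[ℝ] (X → ℝ)) = G := by
  have hunit : IsUnit (1 - LinearMap.toMatrix' (G ∘ₗ (0 : (X₂ → ℝ) →ₗ[ℝ] (X → ℝ)))) := by
    rw [LinearMap.comp_zero, map_zero, sub_zero]
    exact isUnit_one
  conv_lhs => rw [bgPropV_fix hunit]
  rw [LinearMap.comp_zero, LinearMap.zero_comp, add_zero]

/-- At zero coefficients the dressed pair IS the stacked `U ≡ 1` pair `(G, (D_μ)_μ)`. [cite: Balaban1985BackgroundPropagators, (3.64)–(3.65) p.403 (shape)] -/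
theorem bgPairM_zero [Fintype X] [DecidableEq X] [DecidableEq J] [DecidableEq ι] (G : (X × ι → ℝ) →ₗ[ℝ] (X × ι → ℝ)) (D : J → (X × ι → ℝ) →ₗ[ℝ] (X × ι → ℝ)) :
    bgPairM G D (0 : X → Matrix ι ι ℝ) (0 : J → X → Matrix ι ι ℝ) = stack G D := by
  unfold bgPairM
  rw [unstackM_zero, bgPropV_zero_right]

/-- **ENTRY 0 OF THE ALL-COVARIANT DRESSED FAMILY AT ZERO COEFFICIENTS IS THE `U ≡ 1` DEFECT `𝔇(G′, G)`.** [cite: Balaban1985BackgroundPropagators, (3.42) p.397, (3.65) p.403 (shapes)] -/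
theorem bgOpsM₂RCC_zero_of_cfg_zero [Fintype X] [Fintype X'] [DecidableEq X] [DecidableEq X'] [DecidableEq J] [DecidableEq ι] {Cfg : Type}
    (cfgF : Cfg → (X' → Matrix ι ι ℝ) × (J ⊕ J → X' → Matrix ι ι ℝ)) (cfgC : Cfg → (X → Matrix ι ι ℝ) × (J ⊕ J → X → Matrix ι ι ℝ)) (π : X' → X)
    (τ : J → X ≃ X) (τ' : J → X' ≃ X') (n n' : ℝ) (ν : J) (G D₃ : (X × ι → ℝ) →ₗ[ℝ] (X × ι → ℝ)) (D : J ⊕ J → (X × ι → ℝ) →ₗ[ℝ] (X × ι → ℝ))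
    (G' D₃' : (X' × ι → ℝ) →ₗ[ℝ] (X' × ι → ℝ)) (D' : J ⊕ J → (X' × ι → ℝ) →ₗ[ℝ] (X' × ι → ℝ)) (U : Cfg) (hF : cfgF U = (0, 0)) (hC : cfgC U = (0, 0)) :
    bgOpsM₂RCC J ι cfgF cfgC π τ τ' n n' ν G D₃ D G' D₃' D' 0 U = idef (pull (liftMap π ι)) (pull (liftMap π ι)) G' G := by
  show idef (pull (liftMap π ι)) (pull (liftMap π ι)) (projO none ∘ₗ bgPairM G' D' (cfgF U).1 (cfgF U).2) (projO none ∘ₗ bgPairM G D (cfgC U).1 (cfgC U).2) = _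
  rw [hF, hC]
  dsimp only
  rw [bgPairM_zero, bgPairM_zero, projO_none_comp_stack, projO_none_comp_stack]

end ZeroPair

/-! ## §2 The gauge-dressed family at the trivial background: entry 0 is `𝔇(G′, G) ⊗ 1_𝔤 ≠ 0` -/

section Dressed

variable (d) (𝔄 : Type) [NormedRing 𝔄] [NormedAlgebra ℝ 𝔄] [CompleteSpace 𝔄] (ι : Type) [Fintype ι] [DecidableEq ι] [Nonempty ι] (e : 𝔄 ≃L[ℝ] (ι → ℝ))
variable {L : ℕ} [NeZero L]

/-- ★★ **ENTRY 0 OF dag-n15-c's ALL-COVARIANT EXACTLY DRESSED FAMILY AT THE TRIVIAL BACKGROUND `A′ = 0` IS NOT THE ZERO KERNEL** at every index with a genuine scale shift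
`m ≥ 1` (`b > 0`, odd `L > 1`, `d ≥ 1`): there the V′₁ coefficients vanish (§1), the dressed pair is `(G ⊗ 1, …)`, entry 0 is `𝔇(G′, G) ⊗ 1_ι` (`idef_tensorId`), and `𝔇(G′, G) = G′P − PG`
does not vanish (R3 §2) — tested on the `ι`-constant lift of R3's witness. [cite: Balaban1985BackgroundPropagators, (3.42) p.397 (the entry: shape); Balaban1984PropagatorsI, (1.69) p.29] -/
theorem exists_fgFamilyV1XA_e_ne_zero (hd : 1 ≤ d) (hL : Odd L ∧ 1 < L) {b : ℝ} (hb : 0 < b) (i : TGIndex × Fin (d + 1)) (hi : 1 ≤ i.1.m) :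
    ∃ lam y, (fgFamilyV1XA d 𝔄 ι e hL b i).e 0 (fgInstanceV1G d 𝔄 ι hL i).Bf.one lam y ≠ 0 := by
  have h3 : 3 ≤ L := by obtain ⟨r, hr⟩ := hL.1; omega
  obtain ⟨lam, x', hne⟩ := exists_twoGridDefect_apply_ne_zero (TGIndex.Mn d hL i.1) hd h3 i.1.k i.1.m i.1.one_le hi hb
  obtain ⟨j₀⟩ := ‹Nonempty ι›
  -- entry 0 at the trivial background is `𝔇(G′, G) ⊗ 1_ι`
  have h0 : bgOpsM₂RCC (Fin (d + 1)) ι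
      (v1cfgFX 𝔄 ι e (fun μ => VectorPiece.bshiftEquiv (TGIndex.Mn d hL i.1) (L ^ i.1.m * L ^ i.1.k) μ)
        ((unitTorusGeo L i.1.k (TGIndex.Mn d hL i.1)).eta * ((unitTorusGeo L i.1.k (TGIndex.Mn d hL i.1)).L ^ i.1.m)⁻¹))
      (v1cfgCX 𝔄 ι e (kingPrV L i.1.k i.1.m (TGIndex.Mn d hL i.1)) (fun μ => VectorPiece.bshiftEquiv (TGIndex.Mn d hL i.1) (L ^ i.1.k) μ)
        (unitTorusGeo L i.1.k (TGIndex.Mn d hL i.1)).eta)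
      (kingPrV L i.1.k i.1.m (TGIndex.Mn d hL i.1))
      (fun μ => VectorPiece.bshiftEquiv (TGIndex.Mn d hL i.1) (L ^ i.1.k) μ) (fun μ => VectorPiece.bshiftEquiv (TGIndex.Mn d hL i.1) (L ^ i.1.m * L ^ i.1.k) μ)
      ((L ^ i.1.k : ℕ) : ℝ) ((L ^ i.1.m * L ^ i.1.k : ℕ) : ℝ) i.2
      (tensorId ι (gOp (TGIndex.Mn d hL i.1) (L ^ i.1.k) b))
      (tensorId ι (TwoGrid.symbOp (TGIndex.Mn d hL i.1) (L ^ i.1.k) (TwoGrid.sLap (TGIndex.Mn d hL i.1) (L ^ i.1.k) ((L ^ i.1.k : ℕ) : ℝ)) ∘ₗ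
        gOp (TGIndex.Mn d hL i.1) (L ^ i.1.k) b))
      (BackgroundLayer.dPiecesM₂ d ι (TGIndex.Mn d hL i.1) (L ^ i.1.k) b)
      (tensorId ι (gOp (TGIndex.Mn d hL i.1) (L ^ i.1.m * L ^ i.1.k) b))
      (tensorId ι (TwoGrid.symbOp (TGIndex.Mn d hL i.1) (L ^ i.1.m * L ^ i.1.k)
        (TwoGrid.sLap (TGIndex.Mn d hL i.1) (L ^ i.1.m * L ^ i.1.k) ((L ^ i.1.m * L ^ i.1.k : ℕ) : ℝ)) ∘ₗ gOp (TGIndex.Mn d hL i.1) (L ^ i.1.m * L ^ i.1.k) b))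
      (BackgroundLayer.dPiecesM₂ d ι (TGIndex.Mn d hL i.1) (L ^ i.1.m * L ^ i.1.k) b) 0 (fgInstanceV1G d 𝔄 ι hL i).Bf.one =
      tensorId ι (idef (pull (kingPrV L i.1.k i.1.m (TGIndex.Mn d hL i.1))) (pull (kingPrV L i.1.k i.1.m (TGIndex.Mn d hL i.1)))
        (gOp (TGIndex.Mn d hL i.1) (L ^ i.1.m * L ^ i.1.k) b) (gOp (TGIndex.Mn d hL i.1) (L ^ i.1.k) b)) := by
    refine (bgOpsM₂RCC_zero_of_cfg_zero _ _ _ _ _ _ _ _ _ _ _ _ _ _ (fgInstanceV1G d 𝔄 ι hL i).Bf.one (v1cfgFX_zero e _ _) (v1cfgCX_zero e _ _ _)).trans ?_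
    exact idef_tensorId ι _ _ _ _
  refine ⟨fun p => lam p.1, liftBlk (blkFine L i.1.k (TGIndex.Mn d hL i.1) ∘ kingPrV L i.1.k i.1.m (TGIndex.Mn d hL i.1)) ι (x', j₀), fun hz => hne ?_⟩
  -- the entry dominates the value of the entry operator at the fine point `(x′, j₀)` of the cube
  have hle : |(bgOpsM₂RCC (Fin (d + 1)) ι
      (v1cfgFX 𝔄 ι e (fun μ => VectorPiece.bshiftEquiv (TGIndex.Mn d hL i.1) (L ^ i.1.m * L ^ i.1.k) μ)
        ((unitTorusGeo L i.1.k (TGIndex.Mn d hL i.1)).eta * ((unitTorusGeo L i.1.k (TGIndex.Mn d hL i.1)).L ^ i.1.m)⁻¹))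
      (v1cfgCX 𝔄 ι e (kingPrV L i.1.k i.1.m (TGIndex.Mn d hL i.1)) (fun μ => VectorPiece.bshiftEquiv (TGIndex.Mn d hL i.1) (L ^ i.1.k) μ)
        (unitTorusGeo L i.1.k (TGIndex.Mn d hL i.1)).eta)
      (kingPrV L i.1.k i.1.m (TGIndex.Mn d hL i.1))
      (fun μ => VectorPiece.bshiftEquiv (TGIndex.Mn d hL i.1) (L ^ i.1.k) μ) (fun μ => VectorPiece.bshiftEquiv (TGIndex.Mn d hL i.1) (L ^ i.1.m * L ^ i.1.k) μ)
      ((L ^ i.1.k : ℕ) : ℝ) ((L ^ i.1.m * L ^ i.1.k : ℕ) : ℝ) i.2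
      (tensorId ι (gOp (TGIndex.Mn d hL i.1) (L ^ i.1.k) b))
      (tensorId ι (TwoGrid.symbOp (TGIndex.Mn d hL i.1) (L ^ i.1.k) (TwoGrid.sLap (TGIndex.Mn d hL i.1) (L ^ i.1.k) ((L ^ i.1.k : ℕ) : ℝ)) ∘ₗ
        gOp (TGIndex.Mn d hL i.1) (L ^ i.1.k) b))
      (BackgroundLayer.dPiecesM₂ d ι (TGIndex.Mn d hL i.1) (L ^ i.1.k) b)
      (tensorId ι (gOp (TGIndex.Mn d hL i.1) (L ^ i.1.m * L ^ i.1.k) b))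
      (tensorId ι (TwoGrid.symbOp (TGIndex.Mn d hL i.1) (L ^ i.1.m * L ^ i.1.k)
        (TwoGrid.sLap (TGIndex.Mn d hL i.1) (L ^ i.1.m * L ^ i.1.k) ((L ^ i.1.m * L ^ i.1.k : ℕ) : ℝ)) ∘ₗ gOp (TGIndex.Mn d hL i.1) (L ^ i.1.m * L ^ i.1.k) b))
      (BackgroundLayer.dPiecesM₂ d ι (TGIndex.Mn d hL i.1) (L ^ i.1.m * L ^ i.1.k) b) 0 (fgInstanceV1G d 𝔄 ι hL i).Bf.one (fun p => lam p.1)) (x', j₀)| ≤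
      (fgFamilyV1XA d 𝔄 ι e hL b i).e 0 (fgInstanceV1G d 𝔄 ι hL i).Bf.one (fun p => lam p.1)
        (liftBlk (blkFine L i.1.k (TGIndex.Mn d hL i.1) ∘ kingPrV L i.1.k i.1.m (TGIndex.Mn d hL i.1)) ι (x', j₀)) :=
    abs_le_loc_ofBlocks (g := unitTorusGeo L i.1.k (TGIndex.Mn d hL i.1))
      (liftBlk (blkFine L i.1.k (TGIndex.Mn d hL i.1) ∘ kingPrV L i.1.k i.1.m (TGIndex.Mn d hL i.1)) ι) _ rfl
  rw [hz] at hle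
  have h00 := abs_eq_zero.mp (le_antisymm hle (abs_nonneg _))
  rw [h0] at h00
  exact h00

/-- ★★ **R3-bis — THE SIZED GAUGE-DRESSED OPERATOR KERNEL FAMILY IS NOT THE ZERO KERNEL FAMILY** (`b > 0`, `d ≥ 1`, odd `L > 1`; witness: sized index `(1, 1, 1, 1)`, direction
`0`, the TRIVIAL background). [cite: Balaban1985BackgroundPropagators, (3.42) p.397 (shape)] -/
theorem fgFamilyV1XAS_ne_zero (hd : 1 ≤ d) (hL : Odd L ∧ 1 < L) {b : ℝ} (hb : 0 < b) :
    fgFamilyV1XAS d 𝔄 ι e hL b ≠ fun _ => ⟨0, 0, 0, 0, 0, 0⟩ := by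
  intro h
  obtain ⟨lam, y, hne⟩ := exists_fgFamilyV1XA_e_ne_zero d 𝔄 ι e hd hL hb (sizedBase d (⟨⟨1, 1, le_rfl, 1⟩, le_rfl, 1, le_rfl⟩, ⟨0, by omega⟩)) le_rfl
  exact hne (by
    show (fgFamilyV1XAS d 𝔄 ι e hL b (⟨⟨1, 1, le_rfl, 1⟩, le_rfl, 1, le_rfl⟩, ⟨0, by omega⟩)).e 0
      (fgInstanceV1GS d 𝔄 ι hL (⟨⟨1, 1, le_rfl, 1⟩, le_rfl, 1, le_rfl⟩, ⟨0, by omega⟩)).Bf.one lam y = 0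
    rw [h]; rfl)

/-- ★★ **THE ZERO-KERNEL EXCLUSION FOR THE v3 PIN CANDIDATE, OBJECT LEVEL**: an `NE2Objects₁₁` literal all of whose operator kernels vanish is NOT
`v1XASObjects d 𝔄 ι e hL b a_S α β c₃₅ p` (`b > 0`, `d ≥ 1`). [bookkeeping] -/
theorem ne_v1XASObjects_of_kop_zero (hd : 1 ≤ d) (hL : Odd L ∧ 1 < L) {b : ℝ} (hb : 0 < b) (aS : ℝ) (α β : Fin (d + 1)) (c35 p : ℝ) (o : NE2Objects₁₁)
    (hz : ∀ i n U lam y, (o.Kop i).e n U lam y = 0) : o ≠ v1XASObjects d 𝔄 ι e hL b aS α β c35 p := by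
  rintro rfl
  obtain ⟨lam, y, hne⟩ := exists_fgFamilyV1XA_e_ne_zero d 𝔄 ι e hd hL hb (sizedBase d (⟨⟨1, 1, le_rfl, 1⟩, le_rfl, 1, le_rfl⟩, ⟨0, by omega⟩)) le_rfl
  exact hne (hz (⟨⟨1, 1, le_rfl, 1⟩, le_rfl, 1, le_rfl⟩, ⟨0, by omega⟩) 0 _ lam y)

end Dressed

/-! ## §3 Generic: ANY pin target with one non-vanishing operator kernel entry excludes the zero-kernel readings -/

section Generic

variable {N : ℕ} [NeZero N]

/-- **OBJECT LEVEL, GENERIC**: an `NE2Objects₁₁` literal all of whose operator kernels vanish differs from any literal with ONE non-vanishing operator kernel entry (transport of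
the Prop «all operator kernels zero» along the structure equality — never the index-type equality). [bookkeeping] -/
theorem ne_of_kop_zero_of_exists_ne (o o' : NE2Objects₁₁) (hz : ∀ i n U lam y, (o.Kop i).e n U lam y = 0) (h : ∃ i n U lam y, (o'.Kop i).e n U lam y ≠ 0) : o ≠ o' := by
  rintro rfl
  obtain ⟨i, n, U, lam, y, hne⟩ := h
  exact hne (hz i n U lam y)

/-- **READING LEVEL, GENERIC** (the shape of every by-name pin `∃ p, ∀ tuples, (𝔯.lit …).ne2 k = O p F`): if every target `O p F` has a non-vanishing operator kernel entry, then
a reading whose operator kernels vanish at ONE tuple is off the pin — future pins need only their target's non-vanishing letter. [bookkeeping] -/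
theorem not_pin_of_kop_zero {P : Type} (O : P → T4Family → NE2Objects₁₁) (hO : ∀ p F, ∃ i n U lam y, ((O p F).Kop i).e n U lam y ≠ 0) (𝔯 : RateReading₁₃CoPH N)
    {F : T4Family} {θ : Stage13HParams F N} {hP : θ.Provisos₁₃CoPH F N} {g₀ : ℕ → ℝ} {os : List (ULoop F)} {k : ℕ}
    (hz : ∀ i n U lam y, ((((𝔯.lit F θ hP g₀ os).ne2 k).Kop i).e n U lam y) = 0) :
    ¬ ∃ p : P, ∀ (F : T4Family) (θ : Stage13HParams F N) (hP : θ.Provisos₁₃CoPH F N) (g₀ : ℕ → ℝ) (os : List (ULoop F)) (k : ℕ),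
      (𝔯.lit F θ hP g₀ os).ne2 k = O p F := by
  rintro ⟨p, hpin⟩
  exact ne_of_kop_zero_of_exists_ne _ _ hz (hO p F) (hpin F θ hP g₀ os k)

end Generic

/-! ## §4 Reading level (`d + 1 = 4`, any `N`): the body of a v3 pin `N15PinnedV1XAS` fails for every reading whose operator kernels vanish at one tuple -/

section Reading

variable (𝔄 : Type) [NormedRing 𝔄] [NormedAlgebra ℝ 𝔄] [CompleteSpace 𝔄] (ι : Type) [Fintype ι] [DecidableEq ι] [Nonempty ι] (e : 𝔄 ≃L[ℝ] (ι → ℝ))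
variable {N : ℕ} [NeZero N]

/-- ★★★ **R3-bis AT THE READING**: for ANY Stage-13 rate reading `𝔯` and ANY tuple at which ALL operator kernels of `(𝔯.lit F θ hP g₀ os).ne2 k` vanish, the body of the v3 pin
`N15PinnedV1XAS 𝔯` (dag-n15-a S-F's hypothesis shape of `keyedLive_of_pinnedV1XAS`) is FALSE. [bookkeeping] -/
theorem not_v1XASPin_of_kop_zero (𝔯 : RateReading₁₃CoPH N) {F : T4Family} {θ : Stage13HParams F N} {hP : θ.Provisos₁₃CoPH F N} {g₀ : ℕ → ℝ}
    {os : List (ULoop F)} {k : ℕ} (hz : ∀ i n U lam y, ((((𝔯.lit F θ hP g₀ os).ne2 k).Kop i).e n U lam y) = 0) :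
    ¬ ∃ (b aS : ℝ) (α β : Fin 4) (c35 p : ℝ), 0 < b ∧ 0 < aS ∧ 0 < c35 ∧
        ∀ (F : T4Family) (θ : Stage13HParams F N) (hP : θ.Provisos₁₃CoPH F N) (g₀ : ℕ → ℝ) (os : List (ULoop F)) (k : ℕ),
          (𝔯.lit F θ hP g₀ os).ne2 k = haveI := neZero_blockFactor F; v1XASObjects 3 𝔄 ι e F.hL b aS α β c35 p := by
  rintro ⟨b, aS, α, β, c35, p, hb, -, -, hpin⟩
  haveI := neZero_blockFactor F
  exact ne_v1XASObjects_of_kop_zero 3 𝔄 ι e (by norm_num) F.hL hb aS α β c35 p _ hz (hpin F θ hP g₀ os k)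

/-- … EQUIVALENTLY: a reading ON the v3 pin has, at EVERY tuple and run length, a non-vanishing operator kernel entry. [bookkeeping] -/
theorem exists_kop_ne_zero_of_v1XASPin (𝔯 : RateReading₁₃CoPH N)
    (hpin : ∃ (b aS : ℝ) (α β : Fin 4) (c35 p : ℝ), 0 < b ∧ 0 < aS ∧ 0 < c35 ∧
        ∀ (F : T4Family) (θ : Stage13HParams F N) (hP : θ.Provisos₁₃CoPH F N) (g₀ : ℕ → ℝ) (os : List (ULoop F)) (k : ℕ),
          (𝔯.lit F θ hP g₀ os).ne2 k = haveI := neZero_blockFactor F; v1XASObjects 3 𝔄 ι e F.hL b aS α β c35 p)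
    (F : T4Family) (θ : Stage13HParams F N) (hP : θ.Provisos₁₃CoPH F N) (g₀ : ℕ → ℝ) (os : List (ULoop F)) (k : ℕ) :
    ∃ i n U lam y, ((((𝔯.lit F θ hP g₀ os).ne2 k).Kop i).e n U lam y) ≠ 0 := by
  by_contra h
  push Not at h
  exact not_v1XASPin_of_kop_zero 𝔄 ι e 𝔯 h hpin

end Reading

end Summit.QuantumFields.YangMills.BalabanUVNodes.N15.SizedNonVanishing
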